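/- WIDTH seat `ym-line-cbag-p1-w2` (prover-ym-line-cbag-p1-w2-g22-0; own items stmt-QuantumFields-22254 / 22893 CLOSED·proved), LINE 7
`GlueballBandRecursion`, in support of ⟨stmt-QuantumFields-22957⟩ `OneParticleBlochSymbolFamily` (= `Band.EffectiveBlochSymbolFamily`):
the glue door «QUASI-BAND ⇒ ISOLATED BAND», part 2/2 — the TRANSFER MATRIX.  Route-independent; definition-free; a helper. -/
import Summits.QuantumFields.YangMills.Theorems.GlueballBandRecursionQuasiBandIsolation

/-!
# Route `GlueballBandRecursion`, item `OneParticleBlochSymbolFamily` (stmt-QuantumFields-22957): quasi-band isolation for the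
# transfer matrix

What a cluster expansion on the cold `N³` torus delivers is NOT an eigenbasis of the transfer matrix `𝕋 = wilsonTorusTransferMatrix r.ρ β N`
but a QUASI-BAND: a finite-dimensional space `V` of dressed one-plaquette excitations, orthogonal to the ground state `Ω`, on which the
Rayleigh quotient of `𝕋` is `≥ a`, while on the rest of `Ωᗮ` it is `≤ θ`, with an off-diagonal coupling `≤ ε` and a gap `θ + 2ε < a`.  What
the spectral files of the line consume (`…BandUpperGap` §2: `e, μ, Θ, hgap`; `…BlochTransfer`: a covariant orthonormal frame `ψ` of a
`𝕋`-invariant subspace; w3's Löwdin file `…CovariantFrame`: a covariant linearly independent family) is an EXACT isolated band.  This file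
closes that gap once and for all, so that the planner's stub S1 (STUB-PLAN-22957) only has to deliver Rayleigh/coupling bounds.

* §1 (abstract complement to part 1): `eq_inner_smul_of_top` (simple top ⇒ top eigenvectors are multiples of `b_{i₀}`);
  `quasiBand_deflate`: the rank-one deflation `T' = T − λ_{i₀}⟪b_{i₀}, ·⟫b_{i₀}` is symmetric, diagonal in the same basis with eigenvalues
  `update λ i₀ 0`, and turns hypotheses known only on `Vᗮ ∩ b_{i₀}ᗮ` into the unrestricted hypotheses of part 1.
* §2: `koopmanTranslate_transfer_comm`; `starProjection_koopmanTranslate` (`P_W U_v = U_v P_W` for a translation-invariant finite-dimensional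
  `W`); **`exists_isolatedBand_of_quasiBand`** — from (`q_N < 1`, `Ω`, `V`, `a`, `θ`, `ε`) an orthonormal family of `dim V` exact eigenvectors
  `e_k` (indexed by any `κ` with `|κ| = dim V`, e.g. `(ℤ/N)³ × Fin n`), `a − ε ≤ μ_k < λ₊`, ISOLATION in the trichotomy shape of the LEAD's stub
  `Band.IsolatedBandFrame` (`v = 0 ∨ l = λ₊ ∨ l ≤ θ + ε`; `θ + ε = δ·q_min·λ₊` with `q_min λ₊ = a − ε`, `δ = (θ+ε)/(a−ε) < 1`; also the `hgap`
  of `…BandUpperGap` §2), `V` seen by the band, and invariance of `W = span e` under every map commuting with `𝕋`;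
  `projected_quasiBand_frame` — a covariant linearly independent quasi-band frame `φ` projects to a covariant linearly independent frame
  `P_W φ` spanning `W` (the Löwdin input; after orthonormalisation, `transfer_bloch_reduction`'s `ψ` with `span ψ = span e`).

Sources: as in part 1 (Temple–Kato / Davis–Kahan two-block estimates); Montvay–Münster (1994) §3.2.6; R. Schor, Commun. Math. Phys. 92 (1984)
369 (whose one-glueball states are the quasi-band in the application).  Deliberately NOT here: the construction of `V` and its three bounds
(stub S1 proper), the crux-time branch of (P4) (stub S4), the smooth symbol (stub S3).

HONEST FRAMING.  Conditional plumbing for the XL item ⟨stmt-QuantumFields-22957⟩ of LINE 7; the item, the rung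
`ColdDoublingRecursionStrongCoupling` (RECORD-type, strong coupling) and a fortiori the Yang–Mills mass gap / the summit `YangMills` are NOT
proved or advanced here.
-/

set_option autoImplicit false

noncomputable section

open scoped InnerProductSpace BigOperators
open MeasureTheory Filter Topology
open Literature.MathematicalPhysics.QuantumFieldTheory
open Literature.MathematicalPhysics.QuantumFieldTheory.Balaban1983to89.Missing (strongCouplingRadius)

namespace Summit.QuantumFields.YangMills.Theorems.GlueballBandRecursion.Band

/-! ### §1 Abstract complement: a simple top eigenvalue and its deflation -/

section Deflation

variable {E : Type*} [NormedAddCommGroup E] [InnerProductSpace ℝ E]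
variable {ι : Type*} (b : HilbertBasis ι ℝ E)
  (T : E →L[ℝ] E) (hT : (T : E →ₗ[ℝ] E).IsSymmetric) (lam : ι → ℝ) (hb : ∀ i, T (b i) = lam i • b i)
  (i₀ : ι)
include hT hb

/-- **Simple top**: if `λᵢ ≠ λ_{i₀}` off `i₀`, an eigenvector for `λ_{i₀}` is the multiple `⟪b_{i₀}, x⟫ b_{i₀}` of the top basis vector. -/
theorem eq_inner_smul_of_top (htop : ∀ i, i ≠ i₀ → lam i ≠ lam i₀) {x : E} (hx : T x = lam i₀ • x) :
    x = ⟪b i₀, x⟫_ℝ • b i₀ := by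
  classical
  have h := eq_sum_inner_smul_of_inner_eq_zero b {i₀} (x := x) fun j hj => ?_
  · simpa using h
  · rcases eq_or_inner_eq_zero_of_eigen hT (x := b j) (e := x) (l := lam j) (μ := lam i₀)
      (by simpa using hb j) (by simpa using hx) with h | h
    · exact absurd h (htop j (by simpa using hj))
    · exact h

/-- **Deflating the top eigenvalue.**  Let `T' x = T x − λ_{i₀}⟪b_{i₀}, x⟫ b_{i₀}` (the rank-one deflation killing the top basis
vector).  Then `T'` is symmetric, diagonal in the same basis with eigenvalues `update λ i₀ 0`, and a quasi-band `V ⊥ b_{i₀}` whose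
Rayleigh ceiling `θ ≥ 0` and coupling `ε` are only known on the part of `Vᗮ` ORTHOGONAL TO `b_{i₀}` satisfies, for `T'`, the
unrestricted hypotheses of `…QuasiBandIsolation` (same floor `a`, ceiling `θ`, coupling `ε`): for `w ∈ Vᗮ` write `w = w' + ⟪b_{i₀}, w⟫b_{i₀}`,
then `⟪w, T' w⟫ = ⟪w', T w'⟫` and `⟪w, T' v⟫ = ⟪w', T v⟫`, `‖w'‖ ≤ ‖w‖`. [folklore] -/
theorem quasiBand_deflate [DecidableEq ι] (T' : E →L[ℝ] E) (hT' : ∀ x, T' x = T x - (lam i₀ * ⟪b i₀, x⟫_ℝ) • b i₀)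
    (V : Submodule ℝ E) {a θ ε : ℝ} (hθ : 0 ≤ θ) (hε : 0 ≤ ε)
    (hV0 : ∀ v ∈ V, ⟪b i₀, v⟫_ℝ = 0)
    (hV : ∀ v ∈ V, a * ‖v‖ ^ 2 ≤ ⟪v, T v⟫_ℝ)
    (hVp : ∀ w ∈ Vᗮ, ⟪b i₀, w⟫_ℝ = 0 → ⟪w, T w⟫_ℝ ≤ θ * ‖w‖ ^ 2)
    (hcross : ∀ v ∈ V, ∀ w ∈ Vᗮ, ⟪b i₀, w⟫_ℝ = 0 → |⟪w, T v⟫_ℝ| ≤ ε * ‖v‖ * ‖w‖) :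
    (T' : E →ₗ[ℝ] E).IsSymmetric ∧ (∀ i, T' (b i) = Function.update lam i₀ 0 i • b i) ∧
      (∀ v ∈ V, a * ‖v‖ ^ 2 ≤ ⟪v, T' v⟫_ℝ) ∧ (∀ w ∈ Vᗮ, ⟪w, T' w⟫_ℝ ≤ θ * ‖w‖ ^ 2) ∧
      (∀ v ∈ V, ∀ w ∈ Vᗮ, |⟪w, T' v⟫_ℝ| ≤ ε * ‖v‖ * ‖w‖) := by
  have hb00 : ⟪b i₀, b i₀⟫_ℝ = 1 := by
    rw [real_inner_self_eq_norm_sq, b.orthonormal.1 i₀, one_pow]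
  have hsymT : ∀ x y : E, ⟪T x, y⟫_ℝ = ⟪x, T y⟫_ℝ := fun x y => hT x y
  -- `⟪b_{i₀}, T y⟫ = λ_{i₀} ⟪b_{i₀}, y⟫`
  have hb0T : ∀ y : E, ⟪b i₀, T y⟫_ℝ = lam i₀ * ⟪b i₀, y⟫_ℝ := fun y => by
    rw [← hsymT, hb i₀, real_inner_smul_left]
  -- `b_{i₀} ∈ Vᗮ`
  have hb0perp : b i₀ ∈ Vᗮ := by
    rw [Submodule.mem_orthogonal]
    intro u hu
    rw [real_inner_comm]
    exact hV0 u hu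
  refine ⟨?_, ?_, ?_, ?_, ?_⟩
  · -- symmetry
    intro x y
    change ⟪T' x, y⟫_ℝ = ⟪x, T' y⟫_ℝ
    rw [hT' x, hT' y, inner_sub_left, inner_sub_right, real_inner_smul_left, real_inner_smul_right, hsymT,
      real_inner_comm (b i₀) x]
    ring
  · -- eigenbasis
    intro i
    rw [hT' (b i), hb i]
    by_cases hi : i = i₀
    · subst hi
      rw [hb00, mul_one, sub_self, Function.update_self, zero_smul]
    · rw [Function.update_of_ne hi, b.orthonormal.2 (Ne.symm hi), mul_zero, zero_smul, sub_zero]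
  · -- floor on `V`: `T' v = T v`
    intro v hv
    rw [hT' v, hV0 v hv, mul_zero, zero_smul, sub_zero]
    exact hV v hv
  · -- ceiling on `Vᗮ`
    intro w hw
    set c : ℝ := ⟪b i₀, w⟫_ℝ with hc
    set w' : E := w - c • b i₀ with hw'def
    have hw' : w' ∈ Vᗮ := Submodule.sub_mem _ hw (Submodule.smul_mem _ _ hb0perp)
    have hw'0 : ⟪b i₀, w'⟫_ℝ = 0 := by
      rw [hw'def, inner_sub_right, real_inner_smul_right, hb00, mul_one, sub_self]
    have hwsplit : w = w' + c • b i₀ := by rw [hw'def, sub_add_cancel]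
    -- `⟪w, T w⟫ = ⟪w', T w'⟫ + c² λ_{i₀}`
    have hTw : ⟪w, T w⟫_ℝ = ⟪w', T w'⟫_ℝ + lam i₀ * c ^ 2 := by
      have h1 : ⟪w', T (b i₀)⟫_ℝ = 0 := by
        rw [hb i₀, real_inner_smul_right, real_inner_comm, hw'0, mul_zero]
      have h2 : ⟪b i₀, T w'⟫_ℝ = 0 := by rw [hb0T, hw'0, mul_zero]
      conv_lhs => rw [hwsplit]
      rw [map_add, map_smul, inner_add_left, inner_add_right, inner_add_right, real_inner_smul_left,
        real_inner_smul_left, real_inner_smul_right, real_inner_smul_right, h1, h2, hb i₀, real_inner_smul_right, hb00]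
      ring
    have hT'w : ⟪w, T' w⟫_ℝ = ⟪w', T w'⟫_ℝ := by
      rw [hT' w, inner_sub_right, real_inner_smul_right, real_inner_comm (b i₀) w, ← hc, hTw]
      ring
    -- `‖w'‖ ≤ ‖w‖`
    have hnorm : ‖w'‖ ^ 2 ≤ ‖w‖ ^ 2 := by
      have horth : ⟪w', c • b i₀⟫_ℝ = 0 := by
        rw [real_inner_smul_right, real_inner_comm, hw'0, mul_zero]
      have h := norm_add_sq_eq_norm_sq_add_norm_sq_of_inner_eq_zero w' (c • b i₀) horth
      rw [← hwsplit] at h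
      nlinarith [h, mul_self_nonneg ‖c • b i₀‖]
    rw [hT'w]
    exact (hVp w' hw' hw'0).trans (mul_le_mul_of_nonneg_left hnorm hθ)
  · -- coupling
    intro v hv w hw
    set c : ℝ := ⟪b i₀, w⟫_ℝ with hc
    set w' : E := w - c • b i₀ with hw'def
    have hw' : w' ∈ Vᗮ := Submodule.sub_mem _ hw (Submodule.smul_mem _ _ hb0perp)
    have hw'0 : ⟪b i₀, w'⟫_ℝ = 0 := by
      rw [hw'def, inner_sub_right, real_inner_smul_right, hb00, mul_one, sub_self]
    have hwsplit : w = w' + c • b i₀ := by rw [hw'def, sub_add_cancel]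
    have hT'v : T' v = T v := by rw [hT' v, hV0 v hv, mul_zero, zero_smul, sub_zero]
    have hred : ⟪w, T' v⟫_ℝ = ⟪w', T v⟫_ℝ := by
      rw [hT'v, hwsplit, inner_add_left, real_inner_smul_left, hb0T, hV0 v hv, mul_zero, mul_zero, add_zero]
    have hnorm : ‖w'‖ ≤ ‖w‖ := by
      have horth : ⟪w', c • b i₀⟫_ℝ = 0 := by
        rw [real_inner_smul_right, real_inner_comm, hw'0, mul_zero]
      have h := norm_add_sq_eq_norm_sq_add_norm_sq_of_inner_eq_zero w' (c • b i₀) horth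
      rw [← hwsplit] at h
      have h2 : ‖w'‖ ^ 2 ≤ ‖w‖ ^ 2 := by nlinarith [h, mul_self_nonneg ‖c • b i₀‖]
      exact (pow_le_pow_iff_left₀ (norm_nonneg _) (norm_nonneg _) two_ne_zero).1 h2
    rw [hred]
    exact (hcross v hv w' hw' hw'0).trans (mul_le_mul_of_nonneg_left hnorm (mul_nonneg hε (norm_nonneg _)))

end Deflation

/-! ### §2 The transfer matrix: a quasi-band orthogonal to the ground state is an isolated excited band -/

section Transfer

variable {G : Type} [Group G] [TopologicalSpace G] [IsTopologicalGroup G] [CompactSpace G]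
  [MeasurableSpace G] [BorelSpace G]

/-- The Koopman translations commute with the transfer matrix (tree: `wilsonTorusTransferMatrix_compMeasurePreserving_comm`),
in the `koopmanTranslate` spelling of `…BlochTransfer`. -/
theorem koopmanTranslate_transfer_comm (r : LatticeRep G) (β : ℝ) (N : ℕ) [NeZero N] (v : Site 3 N)
    (x : Lp ℝ 2 (Measure.pi fun _ : Edge 3 N => haarProbability G)) :
    koopmanTranslate N v (wilsonTorusTransferMatrix r.ρ β N x) =
      wilsonTorusTransferMatrix r.ρ β N (koopmanTranslate N v x) := by
  haveI : SecondCountableTopology G :=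
    (r.continuous.isClosedEmbedding r.injective).isEmbedding.secondCountableTopology
  exact (wilsonTorusTransferMatrix_compMeasurePreserving_comm β N r.continuous v x).symm

/-- **The orthogonal projection onto a translation-invariant finite-dimensional subspace is translation covariant**:
`P_W (U_v y) = U_v (P_W y)` for the Koopman translations `U_v` whenever `U_v(W) ⊆ W` for all `v` (e.g. the band space of
`exists_isolatedBand_of_quasiBand`, clause (vii) with `L = U_v`). -/
theorem starProjection_koopmanTranslate (N : ℕ) [NeZero N]
    (W : Submodule ℝ (Lp ℝ 2 (Measure.pi fun _ : Edge 3 N => haarProbability G)))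
    [FiniteDimensional ℝ W] [W.HasOrthogonalProjection]
    (hW : ∀ (v : Site 3 N), ∀ x ∈ W, koopmanTranslate N v x ∈ W) (v : Site 3 N)
    (y : Lp ℝ 2 (Measure.pi fun _ : Edge 3 N => haarProbability G)) :
    W.starProjection (koopmanTranslate N v y) = koopmanTranslate N v (W.starProjection y) :=
  starProjection_map_eq_map_starProjection W
    (Lp.compMeasurePreservingₗᵢ ℝ (configTranslate (G := G) v) (measurePreserving_configTranslate v (haarProbability G)))
    (hW v) y

/-- **Quasi-band isolation for the transfer matrix.**  Data: `β ≥ 0`, a period `N` with rate `q_N < 1` (simple top — automatic on the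
strong-coupling window, `rate_lt_one_of_strongCoupling`), a ground state `Ω ≠ 0` (`𝕋 Ω = λ₊ Ω`), and a FINITE-DIMENSIONAL subspace `V` of
the time-zero `L²` — the quasi-band — with `V ⊥ Ω`, a Rayleigh floor `a‖v‖² ≤ ⟪v, 𝕋 v⟫` on `V`, a Rayleigh ceiling `⟪w, 𝕋 w⟫ ≤ θ‖w‖²`
and a coupling `|⟪w, 𝕋 v⟫| ≤ ε‖v‖‖w‖` for `w ∈ Vᗮ ∩ Ωᗮ`, `v ∈ V` (`θ, ε ≥ 0`), and the gap `θ + 2ε < a`; an index type `κ` with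
`|κ| = dim V`.  NO exact eigenvector of `𝕋` other than `Ω` is assumed.  Conclusion: a `κ`-indexed orthonormal family `e` of EXACT
eigenvectors of `𝕋` (i)–(ii) with eigenvalues `a − ε ≤ μ_k < λ₊` (iii); ISOLATION (iv) in the shape of the line's stub
`Band.IsolatedBandFrame` / `Band.UpperGapPropagation`: an eigenvector orthogonal to all `e_k` is `0`, or has the top eigenvalue `λ₊`, or has
eigenvalue `≤ θ + ε` (`= δ·q_min·λ₊` for `q_min λ₊ := a − ε`, `δ := (θ + ε)/(a − ε) < 1`; and the `hgap` clause of `…BandUpperGap` §2 with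
`Θ = θ + ε < min μ`); (v) `V` is SEEN by the band (`v ∈ V`, `v ⊥ e_k ∀ k ⇒ v = 0`: `P_W` is injective on `V`, `W = span e`, `dim W = dim V`);
(vi) `W` is invariant under every linear map commuting with `𝕋` (the Koopman translations: `koopmanTranslate_transfer_comm`, then
`starProjection_koopmanTranslate`, `projected_quasiBand_frame`).  Proof: part 1 for the deflated operator `𝕋 − λ₊⟪b_{i₀}, ·⟫b_{i₀}` in the
tree's eigenbasis `exists_eigenData_rate`. [folklore: Temple–Kato / Davis–Kahan] -/
theorem exists_isolatedBand_of_quasiBand (r : LatticeRep G) {β : ℝ} (hβ : 0 ≤ β) (N : ℕ) [NeZero N]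
    (hq : (⨅ k : ℕ, traceExcess r.ρ β N (k + 2) ^ ((1 : ℝ) / ((k : ℝ) + 2))) < 1)
    (V : Submodule ℝ (Lp ℝ 2 (Measure.pi fun _ : Edge 3 N => haarProbability G))) [FiniteDimensional ℝ V]
    {Ω : Lp ℝ 2 (Measure.pi fun _ : Edge 3 N => haarProbability G)} (hΩ0 : Ω ≠ 0)
    (hΩ : wilsonTorusTransferMatrix r.ρ β N Ω = transferSpectralRadius r.ρ β N • Ω)
    {a θ ε : ℝ} (hθ : 0 ≤ θ) (hε : 0 ≤ ε) (hgap : θ + 2 * ε < a)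
    (hV0 : ∀ v ∈ V, ⟪Ω, v⟫_ℝ = 0)
    (hV : ∀ v ∈ V, a * ‖v‖ ^ 2 ≤ ⟪v, wilsonTorusTransferMatrix r.ρ β N v⟫_ℝ)
    (hVp : ∀ w ∈ Vᗮ, ⟪Ω, w⟫_ℝ = 0 → ⟪w, wilsonTorusTransferMatrix r.ρ β N w⟫_ℝ ≤ θ * ‖w‖ ^ 2)
    (hcross : ∀ v ∈ V, ∀ w ∈ Vᗮ, ⟪Ω, w⟫_ℝ = 0 →
      |⟪w, wilsonTorusTransferMatrix r.ρ β N v⟫_ℝ| ≤ ε * ‖v‖ * ‖w‖)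
    (κ : Type*) [Fintype κ] (hκ : Fintype.card κ = Module.finrank ℝ V) :
    ∃ (e : κ → Lp ℝ 2 (Measure.pi fun _ : Edge 3 N => haarProbability G)) (μ : κ → ℝ),
      Orthonormal ℝ e ∧
      (∀ k, wilsonTorusTransferMatrix r.ρ β N (e k) = μ k • e k) ∧
      (∀ k, a - ε ≤ μ k ∧ μ k < transferSpectralRadius r.ρ β N) ∧
      (∀ (v : Lp ℝ 2 (Measure.pi fun _ : Edge 3 N => haarProbability G)) (l : ℝ),
        wilsonTorusTransferMatrix r.ρ β N v = l • v → (∀ k, ⟪e k, v⟫_ℝ = 0) →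
        v = 0 ∨ l = transferSpectralRadius r.ρ β N ∨ l ≤ θ + ε) ∧
      (∀ v ∈ V, (∀ k, ⟪e k, v⟫_ℝ = 0) → v = 0) ∧
      (∀ L : Lp ℝ 2 (Measure.pi fun _ : Edge 3 N => haarProbability G) →ₗ[ℝ]
          Lp ℝ 2 (Measure.pi fun _ : Edge 3 N => haarProbability G),
        (∀ x, L (wilsonTorusTransferMatrix r.ρ β N x) = wilsonTorusTransferMatrix r.ρ β N (L x)) →
        ∀ x ∈ Submodule.span ℝ (Set.range e), L x ∈ Submodule.span ℝ (Set.range e)) := by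
  classical
  haveI : SecondCountableTopology G :=
    (r.continuous.isClosedEmbedding r.injective).isEmbedding.secondCountableTopology
  obtain ⟨s, _, b, lam, i₀, hb, -, hL0, hrad, -, hqi, -⟩ := exists_eigenData_rate r hβ N
  have hT := (isSelfAdjoint_wilsonTorusTransferMatrix N r.continuous r.mem_unitary β).isSymmetric
  -- simple top
  have htop : ∀ i, i ≠ i₀ → lam i < lam i₀ := fun i hi =>
    (hqi i hi).trans_lt (mul_lt_of_lt_one_left hL0 hq)
  have htop' : ∀ i, i ≠ i₀ → lam i ≠ lam i₀ := fun i hi => (htop i hi).ne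
  -- `Ω = ⟪b_{i₀}, Ω⟫ b_{i₀}` with a non-zero coefficient
  have hΩ' : wilsonTorusTransferMatrix r.ρ β N Ω = lam i₀ • Ω := by rw [hΩ, hrad]
  have hΩeq : Ω = ⟪b i₀, Ω⟫_ℝ • b i₀ := eq_inner_smul_of_top b _ hT lam hb i₀ htop' hΩ'
  have hc0 : ⟪b i₀, Ω⟫_ℝ ≠ 0 := fun h => hΩ0 (by rw [hΩeq, h, zero_smul])
  have hΩof : ∀ w, ⟪b i₀, w⟫_ℝ = 0 → ⟪Ω, w⟫_ℝ = 0 := fun w hw => by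
    rw [hΩeq, real_inner_smul_left, hw, mul_zero]
  have hV0' : ∀ v ∈ V, ⟪b i₀, v⟫_ℝ = 0 := fun v hv => by
    have h := hV0 v hv
    rw [hΩeq, real_inner_smul_left] at h
    exact (mul_eq_zero.1 h).resolve_left hc0
  -- the deflated operator
  set T' : Lp ℝ 2 (Measure.pi fun _ : Edge 3 N => haarProbability G) →L[ℝ]
      Lp ℝ 2 (Measure.pi fun _ : Edge 3 N => haarProbability G) :=
    wilsonTorusTransferMatrix r.ρ β N - lam i₀ • (innerSL ℝ (b i₀)).smulRight (b i₀) with hT'def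
  have hT'app : ∀ x, T' x = wilsonTorusTransferMatrix r.ρ β N x - (lam i₀ * ⟪b i₀, x⟫_ℝ) • b i₀ := fun x => by
    simp only [hT'def, FunLike.coe_sub, FunLike.coe_smul, Pi.sub_apply, Pi.smul_apply,
      ContinuousLinearMap.smulRight_apply, innerSL_apply_apply, smul_smul]
  obtain ⟨hT's, hb', hV', hVp', hcross'⟩ := quasiBand_deflate b _ hT lam hb i₀ T' hT'app V hθ hε hV0' hV
    (fun w hw h0 => hVp w hw (hΩof w h0)) (fun v hv w hw h0 => hcross v hv w hw (hΩof w h0))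
  -- part 1 for `(T', V)`: the window `{i : update λ i₀ 0 i ≥ a − ε}` has exactly `dim V` elements
  obtain ⟨sK, hsK, hcard⟩ :=
    exists_finset_window_card_eq_finrank b T' hT's (Function.update lam i₀ 0) hb' V hε hgap hV' hVp' hcross'
  have hdich := eigenvalue_basis_le_or_le b T' hT's (Function.update lam i₀ 0) hb' V hε hV' hVp' hcross'
  have haε : 0 < a - ε := by linarith
  have hi₀ : i₀ ∉ sK := fun h => by
    have h1 := (hsK i₀).1 h
    rw [Function.update_self] at h1
    linarith
  have hmem : ∀ k, k ∈ sK → k ≠ i₀ ∧ a - ε ≤ lam k := fun k hk => by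
    have hne : k ≠ i₀ := fun h => hi₀ (h ▸ hk)
    have h1 := (hsK k).1 hk
    rw [Function.update_of_ne hne] at h1
    exact ⟨hne, h1⟩
  -- off the window (and off `i₀`) the eigenvalues are `≤ θ + ε`
  have hoff : ∀ j, j ∉ sK → j ≠ i₀ → lam j ≤ θ + ε := fun j hj hj0 => by
    have h1 := (hdich j).resolve_right fun h' => hj ((hsK j).2 h')
    rwa [Function.update_of_ne hj0] at h1
  -- reindex the window by `κ`
  let σ : κ ≃ sK :=
    Fintype.equivOfCardEq (by rw [hκ, ← hcard, Fintype.card_coe])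
  have hrange : Set.range (fun k : κ => (b (σ k) : Lp ℝ 2 (Measure.pi fun _ : Edge 3 N => haarProbability G))) =
      Set.range (fun k : sK => b k) :=
    σ.surjective.range_comp (fun k : sK => b k)
  have hortho_of : ∀ (v : Lp ℝ 2 (Measure.pi fun _ : Edge 3 N => haarProbability G)),
      (∀ k : κ, ⟪b (σ k), v⟫_ℝ = 0) → ∀ j, j ∈ sK → ⟪b j, v⟫_ℝ = 0 := fun v h j hj => by
    simpa using h (σ.symm ⟨j, hj⟩)
  refine ⟨fun k => b (σ k), fun k => lam (σ k), ?_, fun k => hb _, ?_, ?_, ?_, ?_⟩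
  · exact b.orthonormal.comp _ (Subtype.val_injective.comp σ.injective)
  · intro k
    obtain ⟨hne, hge⟩ := hmem (σ k) (σ k).2
    exact ⟨hge, hrad ▸ htop _ hne⟩
  · -- (v) isolation: an eigenvector orthogonal to the band is `0`, the ground direction, or has eigenvalue `≤ θ + ε`
    intro v l hTv hortho
    by_cases hv : v = 0
    · exact Or.inl hv
    by_cases hl : l = transferSpectralRadius r.ρ β N
    · exact Or.inr (Or.inl hl)
    refine Or.inr (Or.inr ?_)
    have hvb0 : ⟪b i₀, v⟫_ℝ = 0 := by
      rcases eq_or_inner_eq_zero_of_eigen hT (x := b i₀) (e := v) (l := lam i₀) (μ := l)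
        (by simpa using hb i₀) (by simpa using hTv) with h | h
      · exact absurd (h.symm.trans hrad.symm) hl
      · exact h
    have hT'v : T' v = l • v := by rw [hT'app, hvb0, mul_zero, zero_smul, sub_zero, hTv]
    rcases eigenvalue_le_or_le_of_quasiBand T' hT's V hε hV' hVp' hcross' hv hT'v with h | h
    · exact h
    · exfalso
      apply hv
      have hcoef : ∀ j, j ∉ (∅ : Finset s) → ⟪b j, v⟫_ℝ = 0 := by
        intro j _
        by_cases hj : j ∈ sK
        · exact hortho_of v hortho j hj
        · by_cases hj0 : j = i₀
          · rw [hj0]; exact hvb0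
          · have hlt : lam j < l := by linarith [hoff j hj hj0]
            rcases eq_or_inner_eq_zero_of_eigen hT (x := b j) (e := v) (l := lam j) (μ := l)
              (by simpa using hb j) (by simpa using hTv) with h' | h'
            · exact absurd h' hlt.ne
            · exact h'
      have h1 := eq_sum_inner_smul_of_inner_eq_zero b ∅ hcoef
      simpa using h1
  · -- (vi) `V` is seen by the band
    intro v hv hortho
    exact eq_zero_of_mem_quasiBand_of_inner_window_eq_zero b T' hT's _ hb' V hε hgap hV' hVp' hcross' hv
      fun i hi => hortho_of v hortho i ((hsK i).2 hi)
  · -- (vii) invariance of the band space under maps commuting with `𝕋`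
    intro L hL x hx
    rw [hrange] at hx ⊢
    refine map_mem_span_window_of_commute b _ hT lam hb sK (fun k hk j hj => ?_) L hL hx
    obtain ⟨hne, hge⟩ := hmem k hk
    by_cases hj0 : j = i₀
    · rw [hj0]
      exact (htop k hne).ne'
    · have h1 := hoff j hj hj0
      intro h
      linarith

/-- **The projected quasi-band frame** (input of the Löwdin orthonormalisation).  Let `e_k` be a finite orthonormal family whose span
`W` SEES a subspace `V` (`v ∈ V`, `v ⊥ e_k ∀ k ⇒ v = 0`) and is invariant under the Koopman translations — conclusions (vi)/(vii) of
`exists_isolatedBand_of_quasiBand` — and let `φ : (ℤ/N)³ × Fin n → V` be a translation-COVARIANT, LINEARLY INDEPENDENT family with as many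
members as the band has eigenvectors.  Then the projected family `ψ⁰_a = P_W φ_a` is linearly independent, translation-covariant, and
spans exactly `W = span e` — so its Löwdin orthonormalisation is a covariant orthonormal frame of the exact band (the `ψ` of
`transfer_bloch_reduction`, with `he_mem`/`hψ_mem` from `span ψ = span e`). -/
theorem projected_quasiBand_frame (N : ℕ) [NeZero N] {K : Type*} [Fintype K]
    {e : K → Lp ℝ 2 (Measure.pi fun _ : Edge 3 N => haarProbability G)} (he : Orthonormal ℝ e)
    [hP : (Submodule.span ℝ (Set.range e)).HasOrthogonalProjection]
    (V : Submodule ℝ (Lp ℝ 2 (Measure.pi fun _ : Edge 3 N => haarProbability G)))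
    (hsee : ∀ v ∈ V, (∀ k, ⟪e k, v⟫_ℝ = 0) → v = 0)
    (hinvar : ∀ (v : Site 3 N), ∀ x ∈ Submodule.span ℝ (Set.range e),
      koopmanTranslate N v x ∈ Submodule.span ℝ (Set.range e))
    {n : ℕ} {φ : Site 3 N × Fin n → Lp ℝ 2 (Measure.pi fun _ : Edge 3 N => haarProbability G)}
    (hφ : LinearIndependent ℝ φ) (hφV : ∀ a, φ a ∈ V)
    (hcov : ∀ (v x : Site 3 N) (j : Fin n), φ (v + x, j) = koopmanTranslate N v (φ (x, j)))
    (hcard : Fintype.card (Site 3 N × Fin n) = Fintype.card K) :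
    LinearIndependent ℝ (fun a => (Submodule.span ℝ (Set.range e)).starProjection (φ a)) ∧
      (∀ (v x : Site 3 N) (j : Fin n), (Submodule.span ℝ (Set.range e)).starProjection (φ (v + x, j)) =
        koopmanTranslate N v ((Submodule.span ℝ (Set.range e)).starProjection (φ (x, j)))) ∧
      Submodule.span ℝ (Set.range fun a => (Submodule.span ℝ (Set.range e)).starProjection (φ a)) =
        Submodule.span ℝ (Set.range e) := by
  haveI : FiniteDimensional ℝ (Submodule.span ℝ (Set.range e)) := Module.Finite.span_of_finite ℝ (Set.finite_range e)
  set W := Submodule.span ℝ (Set.range e) with hWdef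
  -- `P_W` is injective on `V`
  have hinj : ∀ v ∈ V, W.starProjection v = 0 → v = 0 := fun v hv h0 =>
    hsee v hv fun k => (W.mem_orthogonal v).1 (W.starProjection_apply_eq_zero_iff.1 h0) (e k)
      (Submodule.subset_span ⟨k, rfl⟩)
  have hli : LinearIndependent ℝ (fun a => W.starProjection (φ a)) :=
    linearIndependent_starProjection_comp V W hφ hφV hinj
  refine ⟨hli, fun v x j => ?_, ?_⟩
  · rw [hcov, starProjection_koopmanTranslate N W hinvar]
  · exact span_eq_of_linearIndependent_of_card_eq W hli (fun a => W.starProjection_apply_mem (φ a))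
      (hcard.trans (finrank_span_eq_card he.linearIndependent).symm)

end Transfer

end Summit.QuantumFields.YangMills.Theorems.GlueballBandRecursion.Band

end
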